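import Summits.HodgeConjecture.HodgeConjecture.Theses.MarkmanPartnerTransport
import Literature.AlgebraicGeometry.Andre1996.AbelianTypePiecesHodgeClassesMotivated
import Literature.AlgebraicGeometry.Hyperkaehler.HodgeClassesMotivated
import Literature.AlgebraicGeometry.HodgeTheory.AlgebraicClassesPullbackHolds

/-!
# Route MarkmanPartnerTransport · the whole `K3^{[2]}`-sector of the route under Grothendieck's standard
# conjecture `B` (road (R1) of André 1996), BY NAME

The route's items about `K3^{[2]}`-type fourfolds and K3 squares — target #0 `K3Sq2TypeHodge`, cruxes #4
`PicardThreeK3Squares` and #5 `LowPicardRealMultiplication`, supports #2 `PartnerTransport` and #3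
`IsometrySpannedThird` — all follow from Grothendieck's standard conjecture of Lefschetz type `B` (algebraicity of
`*_L`, the tree's `HodgeTheory.StandardConjectureBStar`, for ALL smooth projective complex varieties) together with
two records in print: Soldatenkov 2022 Cor. 1.2 with André 1996 §6.3 (every Hodge class on a projective
`K3^{[n]}`-type variety is MOTIVATED; tree fact
`Hyperkaehler.Soldatenkov2022_hodgeClasses_motivated_K3HilbertType_or_kummerType`) and André 1996 Thm. 0.6.3 / 7.1
(every Hodge class on a product of projective K3 surfaces is motivated; tree fact
`Andre1996.Andre1996_hodgeClasses_motivated_of_isAbelianTypePiece`). Under `B`, motivated ⊆ algebraic by the tree's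
PROVED assembly `Andre1996_motivatedClasses_le_algebraicClasses_of_standardConjectureB_holds_of` (André 1996 §0.3),
whose cup-product input is the tree THEOREM `Voisin2003_cupProduct_algebraicClasses_holds'` (Voisin II Prop. 9.20).

This is the route's "road b05" row (standard conjecture `B`) in kernel form: ONE classical conjecture + two printed
theorems cover every item of the route except the existence statement #9 `PartnerExistence` (proved elsewhere
modulo period surjectivity) and the declared residual #6 `SectorComplement` (= the rest of the Hodge conjecture).
HONEST FRAMING: bookkeeping only — `B` is open; nothing here proves an instance of the Hodge conjecture, the crux,
or moves rung F-H1. No definition, no sorry, no new named fact. Prover seat hodge-nonav-19652-p1 (gen 17),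
`--supports stmt-HodgeConjecture-19652`.

References: Y. André, *Pour une théorie inconditionnelle des motifs*, Publ. Math. IHÉS 83 (1996), §0.3, Thm. 0.6.3,
§6.3, Thm. 7.1; A. Soldatenkov, *Deformation principle and André motives of projective hyperkähler manifolds*,
Int. Math. Res. Not. 2022, Cor. 1.2, §2.2; C. Voisin, *Hodge Theory and Complex Algebraic Geometry II*, Prop. 9.20;
A. Grothendieck, *Standard conjectures on algebraic cycles* (Bombay 1968).
-/

noncomputable section

set_option linter.dupNamespace false

open CategoryTheory MonoidalCategory
open Literature.AlgebraicGeometry Literature.AlgebraicGeometry.Motives Literature.AlgebraicGeometry.HodgeTheory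
open Literature.AlgebraicGeometry.Hyperkaehler Literature.AlgebraicGeometry.Surfaces
open Literature.AlgebraicGeometry.Andre1996

namespace Summit.HodgeConjecture.HodgeConjecture.Theorems.MarkmanPartnerTransport.StandardBRoad

/-- **`B` ⟹ HC⁴ for every smooth projective `K3^{[2]}`-type fourfold**, modulo Soldatenkov 2022 / André 1996
(Hodge ⟹ motivated on `K3^{[n]}`-type) BY NAME; the cup-product input is the tree theorem
`Voisin2003_cupProduct_algebraicClasses_holds'`. [cite: Soldatenkov2022, Cor. 1.2 (§1.1) and §2.2]
[cite: Andre1996Motifs, §0.3 (p. 7) and §6.3 (p. 31)] -/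
theorem hodgeConjectureFor_k3HilbertSquareType_of_standardB
    (hSo : Soldatenkov2022_hodgeClasses_motivated_K3HilbertType_or_kummerType) (hB : ∀ (d : ℕ) (Z : SchemeOver ℂ) (η : complexBetti Z 2), IsSmoothProjective d Z → StandardConjectureBStar d Z η)
    {X : SchemeOver ℂ} (hX : IsSmoothProjective 4 X) (hK : IsOfK3HilbertSquareType X) :
    HodgeConjectureFor 4 X :=
  Soldatenkov2022_hodgeClasses_motivated_K3HilbertType_or_kummerType.hodgeClasses_algebraic_of_lefschetzStandardB
    (n := 2) hSo Voisin2003_cupProduct_algebraicClasses_holds' hB hX (Or.inl hK)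

/-- **`B` ⟹ HC⁴ for the self-product `S ⊗ S` of every projective K3 surface**, modulo André 1996 Thm. 0.6.3 / 7.1
(Hodge ⟹ motivated on products of K3 surfaces) BY NAME. [cite: Andre1996Motifs, Thm. 7.1 (p. 35) and §6.3 (p. 31)] -/
theorem hodgeConjectureFor_square_of_standardB
    (hA : Andre1996_hodgeClasses_motivated_of_isAbelianTypePiece) (hB : ∀ (d : ℕ) (Z : SchemeOver ℂ) (η : complexBetti Z 2), IsSmoothProjective d Z → StandardConjectureBStar d Z η)
    {S : SchemeOver ℂ} (hS : IsK3Surface S) : HodgeConjectureFor 4 (S ⊗ S) :=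
  Andre1996_hodgeClasses_motivated_of_isAbelianTypePiece.hodgeConjectureFor_of_lefschetzStandardB hA
    Voisin2003_cupProduct_algebraicClasses_holds' hB (IsAbelianTypePiece.k3_tensor_k3 hS hS)

/-- **Target #0 `K3Sq2TypeHodge` under `B`** (modulo Soldatenkov 2022 BY NAME): the marking `(φ, P, z)` is not
used. [cite: Soldatenkov2022, Cor. 1.2 (§1.1) and §2.2] [cite: Andre1996Motifs, §0.3 (p. 7)] -/
theorem k3Sq2TypeHodge_of_standardB
    (hSo : Soldatenkov2022_hodgeClasses_motivated_K3HilbertType_or_kummerType) (hB : ∀ (d : ℕ) (Z : SchemeOver ℂ) (η : complexBetti Z 2), IsSmoothProjective d Z → StandardConjectureBStar d Z η) :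
    Summit.HodgeConjecture.HodgeConjecture.Theses.MarkmanPartnerTransport.K3Sq2TypeHodge := by
  intro X hX hK _ _ _ _
  exact hodgeConjectureFor_k3HilbertSquareType_of_standardB hSo hB hX hK

/-- **Crux #4 `PicardThreeK3Squares` under `B`** (modulo André 1996 BY NAME): the marking `(η, p, x)` and the
Picard-rank hypothesis `3 ≤ ρ(S)` are not used. [cite: Andre1996Motifs, Thm. 7.1 (p. 35) and §6.3 (p. 31)] -/
theorem picardThreeK3Squares_of_standardB
    (hA : Andre1996_hodgeClasses_motivated_of_isAbelianTypePiece) (hB : ∀ (d : ℕ) (Z : SchemeOver ℂ) (η : complexBetti Z 2), IsSmoothProjective d Z → StandardConjectureBStar d Z η) :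
    Summit.HodgeConjecture.HodgeConjecture.Theses.MarkmanPartnerTransport.PicardThreeK3Squares := by
  intro S hS _ _ _ _ _
  exact hodgeConjectureFor_square_of_standardB hA hB hS

/-- **Crux #5 `LowPicardRealMultiplication` under `B`** (modulo Soldatenkov 2022 BY NAME): the real-multiplication
and `ρ(X) ≤ 3` hypotheses are not used. [cite: Soldatenkov2022, Cor. 1.2 (§1.1) and §2.2] -/
theorem lowPicardRealMultiplication_of_standardB
    (hSo : Soldatenkov2022_hodgeClasses_motivated_K3HilbertType_or_kummerType) (hB : ∀ (d : ℕ) (Z : SchemeOver ℂ) (η : complexBetti Z 2), IsSmoothProjective d Z → StandardConjectureBStar d Z η) :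
    Summit.HodgeConjecture.HodgeConjecture.Theses.MarkmanPartnerTransport.LowPicardRealMultiplication := by
  intro X hX hK _ _ _ _ _ _
  exact hodgeConjectureFor_k3HilbertSquareType_of_standardB hSo hB hX hK

/-- **Support #2 `PartnerTransport` under `B`** (modulo Soldatenkov 2022 BY NAME): the partner data and the
hypothesis HC⁴(S ⊗ S) are not used. [cite: Soldatenkov2022, Cor. 1.2 (§1.1) and §2.2] -/
theorem partnerTransport_of_standardB
    (hSo : Soldatenkov2022_hodgeClasses_motivated_K3HilbertType_or_kummerType) (hB : ∀ (d : ℕ) (Z : SchemeOver ℂ) (η : complexBetti Z 2), IsSmoothProjective d Z → StandardConjectureBStar d Z η) :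
    Summit.HodgeConjecture.HodgeConjecture.Theses.MarkmanPartnerTransport.PartnerTransport := by
  intro X hX hK _ _ _ _ _ _ _ _ _ _ _ _ _
  exact hodgeConjectureFor_k3HilbertSquareType_of_standardB hSo hB hX hK

/-- **Support #3 `IsometrySpannedThird` under `B`** (modulo Soldatenkov 2022 BY NAME): the isometry-spanning
hypothesis is not used. [cite: Soldatenkov2022, Cor. 1.2 (§1.1) and §2.2] -/
theorem isometrySpannedThird_of_standardB
    (hSo : Soldatenkov2022_hodgeClasses_motivated_K3HilbertType_or_kummerType) (hB : ∀ (d : ℕ) (Z : SchemeOver ℂ) (η : complexBetti Z 2), IsSmoothProjective d Z → StandardConjectureBStar d Z η) :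
    Summit.HodgeConjecture.HodgeConjecture.Theses.MarkmanPartnerTransport.IsometrySpannedThird := by
  intro X hX hK _ _ _ _ _
  exact hodgeConjectureFor_k3HilbertSquareType_of_standardB hSo hB hX hK

/-- **The route modulo `B`, two André-type records, partner existence and the residual**: feeding the five items above
into the route's deciding theorem `closes` leaves exactly #9 `PartnerExistence` and #6 `SectorComplement` as
hypotheses. (Of course `SectorComplement` — the Hodge conjecture off the `K3^{[2]}` sector — is summit-strength; this
corollary only records which inputs the route's own sector consumes under `B`.)
[cite: Andre1996Motifs, §0.3 (p. 7), Thm. 0.6.3 (p. 9)] [cite: Soldatenkov2022, Cor. 1.2 (§1.1)] -/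
theorem hodgeConjecture_of_standardB_of_partnerExistence_of_sectorComplement
    (hSo : Soldatenkov2022_hodgeClasses_motivated_K3HilbertType_or_kummerType)
    (hA : Andre1996_hodgeClasses_motivated_of_isAbelianTypePiece) (hB : ∀ (d : ℕ) (Z : SchemeOver ℂ) (η : complexBetti Z 2), IsSmoothProjective d Z → StandardConjectureBStar d Z η)
    (h₆ : Summit.HodgeConjecture.HodgeConjecture.Theses.MarkmanPartnerTransport.PartnerExistence)
    (hC : Summit.HodgeConjecture.HodgeConjecture.Theses.MarkmanPartnerTransport.SectorComplement) :
    _root_.HodgeConjecture :=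
  Summit.HodgeConjecture.HodgeConjecture.Theses.MarkmanPartnerTransport.closes
    (partnerTransport_of_standardB hSo hB) (isometrySpannedThird_of_standardB hSo hB)
    (picardThreeK3Squares_of_standardB hA hB) (lowPicardRealMultiplication_of_standardB hSo hB) h₆ hC

end Summit.HodgeConjecture.HodgeConjecture.Theorems.MarkmanPartnerTransport.StandardBRoad

end
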